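import Literature.NumberTheory.Automorphic.Qian2022PotentialAutomorphy
import Literature.NumberTheory.Automorphic.AHTW2026LocalGlobalAtP
import HarnessLib

/-!
# A'Campo–Hevesi–Thorne–Whitmore 2026, Thm. 1.2.1: the EXACT labelled Hodge–Tate weights of
# `r_{π,ι}` at `v ∣ p`, read off the infinity type of `π` (regular algebraic cuspidal, CM field)

Topic `NumberTheory/Automorphic` (vocabulary of `ReciprocityGLn` / `AutomorphicRepsGL`:
`CuspidalAutomorphicRepData`, `AutomorphicRepData.HasInfinityType`, `InfinityType`,
`InfinityType.IsRegularAlgebraic`, `ArchWeight.a`; of `Qian2022PotentialAutomorphy`: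
`Qian2022.IsCompatible` (the characterising property of `r_{l,ι}(π)`); of the Galois-representation
files: `FramedGaloisRep`, `labelledHodgeTateWeightsAt` (`LabelledHodgeTateWeights`),
`PstWeilDeligneData` (`PstWeilDeligne`)).  Companion of the accepted
`AHTW2026.deRham_hodgeTateRegular` (`AHTW2026LocalGlobalAtP`), which vendors only the consequence
"the labelled weights are multiplicity-free" of the same printed clause, recording (module
docstring, "Rendering") that "the exact values `λ_{ιτ,j} + n − j` would need the weight `λ` of `π` as
a typed function of the embeddings `K → ℂ`".  That function IS available: the accepted
`AutomorphicRepData.HasInfinityType T` exposes the Harish-Chandra parameter of `π_∞` embedding by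
embedding as the multisets of `z`-exponents `{a : (a, b) ∈ T σ}` (`AutomorphicRepsGL`, D3), and the
printed weight `λ` is a bookkeeping of exactly these multisets (dictionary below).  This file vendors
the exact clause.

L. A'Campo, B. Hevesi, J. A. Thorne, D. Whitmore, *Local-global compatibility of automorphic Galois
representations over CM fields at `p`*, arXiv:2607.11763 (2026), **Theorem 1.2.1** (p. 5 of the held
text `paper:arxiv-2607.11763`, read 2026-08-17), as printed:

> 1.2.1. Theorem. Let `F` be a CM number field, let `n ≥ 1`, and let `ι : ℚ̄_p → ℂ` be an
> isomorphism. Let `π` be a cuspidal, regular algebraic automorphic representation of `GL_n(𝔸_F)` of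
> weight `λ`. Then for any place `v | p` of `F`, the representation `r_{π,ι}|_{G_{F_v}}` is de Rham of
> Hodge–Tate weights `HT_τ(r_{π,ι}) = {λ_{ιτ,1} + (n−1), λ_{ιτ,2} + (n−2), …, λ_{ιτ,n}}`, and there
> is an isomorphism `WD(r_{π,ι}|_{G_{F_v}})^{ss} ≅ ι⁻¹ rec^T_{F_v}(π_v)^{ss}`.

with (p. 4) "the weight `λ = (λ_τ)_τ ∈ (ℤⁿ)^{Hom(F,ℂ)}` is defined by the requirement that `π_∞` have
the same infinitesimal character as `V_λ^∨`, where `V_λ` is the algebraic representation of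
`GL_n(F ⊗_ℚ ℂ) ≅ ∏_τ GL_n(ℂ)` of highest weight `λ`", and (§1.4, p. 9) "we write `HT_τ(ρ)` for the
multiset of integers `i` such that `gr^i(ρ ⊗_{τ,K} B_dR)^{G_K} ≠ 0` … if `ρ` is the `p`-adic
cyclotomic character, we have `HT_τ(ρ) = {−1}` for all `τ`" — the convention of the tree's
`PeriodRingData.labelledHodgeTateWeights` ([BLGGT] Notation; clause (F11) of `FontaineDpst`).

NAMED FACT (D-0014): the proof (degree shifting on `U(n,n)`) is far out of reach of the library.
Requested by crux `stmt-Langlands-17009` (`NonParallelVoid.TensorSquareParallel`, line `merged`,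
stub `stub_ordinaryDihedralVoid`: automorphy of `ρ|_{Γ_{K'}}` over a CM field + THIS fact + Clozel's
purity lemma (PROVED in the tree, `CuspidalAutomorphicRepData.purity`) force equal Hodge–Tate gaps
at complex-conjugate embeddings); also the natural input of the sibling cruxes
`TwistedInductionParallel`, `LocallyReducibleParallel` of route `NonParallelVoid`.

## The dictionary `λ ↔ T` (why the vendored formula is the printed one)

For `π` with infinity type `T` (`HasInfinityType T`: at each `σ : K →+* ℂ` the multiset
`A_T(σ) = {a : (a, b) ∈ T σ}` is the Harish-Chandra parameter of `π_∞` at `σ`, i.e. the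
`σ`-component of its infinitesimal character; `HarishChandraGL`, `ArchimedeanGLn`).  The algebraic
representation `V_{λ_σ}^∨` of `GL_n(ℂ)` has highest weight `(−λ_{σ,n}, …, −λ_{σ,1})` and
infinitesimal character (Harish-Chandra parameter) `(−λ_{σ,n}, …, −λ_{σ,1}) + ρ`,
`ρ = ((n−1)/2, (n−3)/2, …, (1−n)/2)`, i.e. the multiset `{−λ_{σ,i} + i − (n+1)/2 : i = 1, …, n}`.
Hence "`π` of weight `λ`" reads `A_T(σ) = {−λ_{σ,i} + i − (n+1)/2}_i`, and the printed weights are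
`{λ_{ιτ,i} + n − i}_i = {(n−1)/2 − a : a ∈ A_T(ιτ)}` — the member at `s = (1−n)/2` of the tree's
`InfinityType.hodgeTateWeights (T.twist s)` (`= {−(a + s)}`: Buzzard–Gee's recipe `HT = −a` for the
L-algebraic twist `π|det|^{(1−n)/2}`, `rec^T(π) = rec(π|·|^{(1−n)/2})`, loc. cit. §1.4).  Checks:
`n = 1`, `π = |·|_𝔸` (`a = b = 1`): `HT = {−1} = HT(ε)`; weight zero (`λ = 0`,
`A_T(σ) = {ρ_i}`, accepted `weightZeroInfinityType`): `HT = {0, 1, …, n−1}`, the weights of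
hypothesis (2) of the accepted `ACCGHLNSTT2023.automorphyLifting_crystalline_weightZero`.

## Rendering (WEAKER than the source where it deviates, never stronger)

* "`r ≅ r_{π,ι}`" is rendered, exactly as in the accepted `Qian2022.IsAutomorphic` (Def. 1.3 of
  Qian 2023), as: `r` is semisimple and has the characterising property `Qian2022.IsCompatible π ι r`
  (for every rational prime `q ≠ ℓ` above which `π` AND `K` are unramified and every `v ∣ q`, `r` is
  unramified at `v` with the predicted characteristic polynomial of Frobenius).  `r_{π,ι}` is by
  definition the unique continuous semisimple representation with this property (the places in
  question have Dirichlet density one: Chebotarev + Brauer–Nesbitt), so the statement is about the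
  `GL_n(ℚ̄_ℓ)`-conjugates of `r_{π,ι}`, of which the labelled Hodge–Tate weights are invariants
  (`LabelledWeightsInvariance`).  The published (stronger) property
  `HarrisLanTaylorThorne2016.IsCompatible` implies Qian's (`Qian2022.isCompatible_of_hltt`), whence the
  corollary `hodgeTateWeights_eq_of_hltt` in the currency of `AHTW2026.deRham_hodgeTateRegular`.
  This choice makes the fact consumable on the output of `Qian2022.potentialAutomorphy_ordinary`.
* "of weight `λ`" is rendered by ANY infinity type `T` of `π` with `T.IsRegularAlgebraic`
  (`π.1.HasInfinityType T`; the `a`-multisets of all infinity types of `π` coincide, being the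
  Harish-Chandra parameter of `π_∞`), through the dictionary above.
* The `p`-adic Hodge datum `𝓓 K p v` at `v ∣ p` is a PARAMETER (intended: Fontaine's
  `(B_dR(K_v), WD ∘ D_pst)`, the summit's `fontainePstAdicCompletion v p hv`), as in the accepted
  `AHTW2026.deRham_hodgeTateRegular`, `Qian2022.potentialAutomorphy_ordinary`; labels are the
  `ℚ_ℓ`-algebra embeddings `τ : K_v →ₐ[ℚ_ℓ] ℚ̄_ℓ` for the datum's `ℚ_ℓ`-structure (for a continuous
  structure map these are exactly the continuous embeddings, `HodgeTateLabel.equivPadicAlgHom`), and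
  `ιτ` is the complex embedding `ι ∘ τ ∘ (K → K_v) : K →+* ℂ`.
* The equality of multisets is stated in `ℂ` (`Multiset.map Int.cast` of the integer weights), the
  exponents `a` being complex numbers in `(n−1)/2 + ℤ`.
* The de Rham clause and the `WD^{ss}` clause are not restated (the former is the accepted
  `AHTW2026.isDeRhamFramed_of_isCompatible`; no `rec` for ramified `π_v` in the tree).

## References

* [AHTW2026] L. A'Campo, B. Hevesi, J. A. Thorne, D. Whitmore, arXiv:2607.11763, Thm. 1.2.1 (p. 5),
  §1.1 (p. 4: the weight `λ`, `V_λ^∨`), §1.4 (p. 9: `HT_τ`, `HT_τ(ε) = {−1}`, `rec^T`).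
* [Qian2022] L. Qian, *Potential automorphy for `GL_n`*, Invent. Math. 231 (2023), Def. 1.3.
* [BuzzardGeeLMS2014] K. Buzzard, T. Gee, *The conjectural connections …*, §2.4, §3.1 (the recipe
  `HT = −a`; C- versus L-algebraic twist by `|det|^{(n−1)/2}`).
* [Clozel1990] L. Clozel, *Motifs et formes automorphes*, §3.3 (type à l'infini), Lemme 4.9.
-/

noncomputable section

open scoped NumberField
open NumberField IsDedekindDomain Filter
open Literature.NumberTheory.GaloisRepresentations

namespace Literature.NumberTheory.Automorphic

namespace AHTW2026

/-- **A'Campo–Hevesi–Thorne–Whitmore 2026, Theorem 1.2.1 (exact Hodge–Tate weights)**, NAMED FACT,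
relative to `p`-adic Hodge data `𝓓 K p v` at the places `v ∣ p` of number fields (a parameter; the
printed theorem is the member at Fontaine's `(B_dR(K_v), WD ∘ D_pst)`).  For every CM number field
`K`, every `n ≥ 1`, every cuspidal `π` on `GL_n(𝔸_K)` with a regular algebraic infinity type `T`
("regular algebraic of weight `λ`", `A_T(σ) = {−λ_{σ,i} + i − (n+1)/2}_i`), every prime `ℓ`,
`ι : ℚ̄_ℓ ≃ ℂ` and every continuous semisimple `r : Γ_K → GL_n(ℚ̄_ℓ)` with the characterising
property of `r_{ℓ,ι}(π)` (`Qian2022.IsCompatible π ι r`, i.e. `r ≅ r_{π,ι}`): at every place `v ∣ ℓ`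
and every label `τ : K_v →ₐ[ℚ_ℓ] ℚ̄_ℓ` (for the datum's `ℚ_ℓ`-structure), the `τ`-labelled
Hodge–Tate weights of `r` (`labelledHodgeTateWeightsAt`, convention `HT(ε) = {−1}`) are
`{λ_{ιτ,1} + (n−1), …, λ_{ιτ,n}} = {(n−1)/2 − a : a ∈ A_T(ιτ)}`, `ιτ = ι ∘ τ ∘ (K → K_v)`, as
multisets of complex numbers. [cite: AHTW2026, Thm. 1.2.1 (Hodge–Tate weights clause), with §1.1 (weight λ) and §1.4 (HT_τ)] -/
def hodgeTateWeights_eq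
    (𝓓 : ∀ (K : Type) [Field K] [NumberField K] (p : ℕ) [Fact p.Prime]
      (v : HeightOneSpectrum (𝓞 K)), ((p : ℕ) : 𝓞 K) ∈ v.asIdeal →
        PstWeilDeligneData (v.adicCompletion K) p) : Prop :=
  ∀ (K : Type) [Field K] [NumberField K], IsCMField K →
    ∀ (n : ℕ), 1 ≤ n →
    ∀ (hcpt : isCompact_glFiniteIntegralLevel n K) (π : CuspidalAutomorphicRepData n K hcpt)
      (T : InfinityType K n), π.1.HasInfinityType T → T.IsRegularAlgebraic →
    ∀ (ℓ : ℕ) [Fact ℓ.Prime] (ι : PadicAlgCl ℓ ≃+* ℂ) (r : FramedGaloisRep K (PadicAlgCl ℓ) n),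
      r.toGaloisRep.IsSemisimple → Qian2022.IsCompatible π.1 ι r →
      ∀ (v : HeightOneSpectrum (𝓞 K)) (hv : ((ℓ : ℕ) : 𝓞 K) ∈ v.asIdeal),
        letI := (𝓓 K ℓ v hv).algebra
        ∀ τ : v.adicCompletion K →ₐ[ℚ_[ℓ]] PadicAlgCl ℓ,
          (r.labelledHodgeTateWeightsAt v (𝓓 K ℓ v hv).algebra (𝓓 K ℓ v hv).𝔅 τ.toRingHom).map
              (fun h : ℤ => (h : ℂ)) =
            ((T (ι.toRingHom.comp (τ.toRingHom.comp (algebraMap K (v.adicCompletion K))))).map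
                ArchWeight.a).map (fun a : ℂ => ((n : ℂ) - 1) / 2 - a)

/-- Unfolding lemma for `hodgeTateWeights_eq`. [folklore] -/
theorem hodgeTateWeights_eq_iff
    (𝓓 : ∀ (K : Type) [Field K] [NumberField K] (p : ℕ) [Fact p.Prime]
      (v : HeightOneSpectrum (𝓞 K)), ((p : ℕ) : 𝓞 K) ∈ v.asIdeal →
        PstWeilDeligneData (v.adicCompletion K) p) :
    hodgeTateWeights_eq 𝓓 ↔
      ∀ (K : Type) [Field K] [NumberField K], IsCMField K →
        ∀ (n : ℕ), 1 ≤ n →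
        ∀ (hcpt : isCompact_glFiniteIntegralLevel n K) (π : CuspidalAutomorphicRepData n K hcpt)
          (T : InfinityType K n), π.1.HasInfinityType T → T.IsRegularAlgebraic →
        ∀ (ℓ : ℕ) [Fact ℓ.Prime] (ι : PadicAlgCl ℓ ≃+* ℂ) (r : FramedGaloisRep K (PadicAlgCl ℓ) n),
          r.toGaloisRep.IsSemisimple → Qian2022.IsCompatible π.1 ι r →
          ∀ (v : HeightOneSpectrum (𝓞 K)) (hv : ((ℓ : ℕ) : 𝓞 K) ∈ v.asIdeal),
            letI := (𝓓 K ℓ v hv).algebra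
            ∀ τ : v.adicCompletion K →ₐ[ℚ_[ℓ]] PadicAlgCl ℓ,
              (r.labelledHodgeTateWeightsAt v (𝓓 K ℓ v hv).algebra (𝓓 K ℓ v hv).𝔅 τ.toRingHom).map
                  (fun h : ℤ => (h : ℂ)) =
                ((T (ι.toRingHom.comp (τ.toRingHom.comp (algebraMap K (v.adicCompletion K))))).map
                    ArchWeight.a).map (fun a : ℂ => ((n : ℂ) - 1) / 2 - a) :=
  Iff.rfl

/-- **The same in the currency of the published characterising property** (hypothesis
`HarrisLanTaylorThorne2016.IsCompatible`, as in the accepted `AHTW2026.deRham_hodgeTateRegular`):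
HLTT's property implies Qian's (`Qian2022.isCompatible_of_hltt`). [cite: AHTW2026, Thm. 1.2.1] -/
theorem hodgeTateWeights_eq_of_hltt
    {𝓓 : ∀ (K : Type) [Field K] [NumberField K] (p : ℕ) [Fact p.Prime]
      (v : HeightOneSpectrum (𝓞 K)), ((p : ℕ) : 𝓞 K) ∈ v.asIdeal →
        PstWeilDeligneData (v.adicCompletion K) p}
    (h : hodgeTateWeights_eq 𝓓) {K : Type} [Field K] [NumberField K] (hK : IsCMField K)
    {n : ℕ} (hn : 1 ≤ n) {hcpt : isCompact_glFiniteIntegralLevel n K}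
    (π : CuspidalAutomorphicRepData n K hcpt) {T : InfinityType K n} (hT : π.1.HasInfinityType T)
    (hreg : T.IsRegularAlgebraic) {ℓ : ℕ} [Fact ℓ.Prime] (ι : PadicAlgCl ℓ ≃+* ℂ)
    {r : FramedGaloisRep K (PadicAlgCl ℓ) n} (hss : r.toGaloisRep.IsSemisimple)
    (hc : HarrisLanTaylorThorne2016.IsCompatible π.1 ι r)
    (v : HeightOneSpectrum (𝓞 K)) (hv : ((ℓ : ℕ) : 𝓞 K) ∈ v.asIdeal) :
    letI := (𝓓 K ℓ v hv).algebra
    ∀ τ : v.adicCompletion K →ₐ[ℚ_[ℓ]] PadicAlgCl ℓ,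
      (r.labelledHodgeTateWeightsAt v (𝓓 K ℓ v hv).algebra (𝓓 K ℓ v hv).𝔅 τ.toRingHom).map
          (fun h : ℤ => (h : ℂ)) =
        ((T (ι.toRingHom.comp (τ.toRingHom.comp (algebraMap K (v.adicCompletion K))))).map
            ArchWeight.a).map (fun a : ℂ => ((n : ℂ) - 1) / 2 - a) :=
  h K hK n hn hcpt π T hT hreg ℓ ι r hss (Qian2022.isCompatible_of_hltt hc) v hv

/-- **Regularity read back**: under the fact, the labelled weights of `r ≅ r_{π,ι}` are
multiplicity-free at every label (the `a`-exponents of a regular infinity type are pairwise distinct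
and `a ↦ (n−1)/2 − a`, `h ↦ (h : ℂ)` are injective) — the Hodge–Tate clause of the accepted
`AHTW2026.deRham_hodgeTateRegular`, here for `ℚ_ℓ`-algebra labels. [cite: AHTW2026, Thm. 1.2.1] -/
theorem nodup_labelledHodgeTateWeightsAt
    {𝓓 : ∀ (K : Type) [Field K] [NumberField K] (p : ℕ) [Fact p.Prime]
      (v : HeightOneSpectrum (𝓞 K)), ((p : ℕ) : 𝓞 K) ∈ v.asIdeal →
        PstWeilDeligneData (v.adicCompletion K) p}
    (h : hodgeTateWeights_eq 𝓓) {K : Type} [Field K] [NumberField K] (hK : IsCMField K)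
    {n : ℕ} (hn : 1 ≤ n) {hcpt : isCompact_glFiniteIntegralLevel n K}
    (π : CuspidalAutomorphicRepData n K hcpt) {T : InfinityType K n} (hT : π.1.HasInfinityType T)
    (hreg : T.IsRegularAlgebraic) {ℓ : ℕ} [Fact ℓ.Prime] (ι : PadicAlgCl ℓ ≃+* ℂ)
    {r : FramedGaloisRep K (PadicAlgCl ℓ) n} (hss : r.toGaloisRep.IsSemisimple)
    (hc : Qian2022.IsCompatible π.1 ι r)
    (v : HeightOneSpectrum (𝓞 K)) (hv : ((ℓ : ℕ) : 𝓞 K) ∈ v.asIdeal) :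
    letI := (𝓓 K ℓ v hv).algebra
    ∀ τ : v.adicCompletion K →ₐ[ℚ_[ℓ]] PadicAlgCl ℓ,
      (r.labelledHodgeTateWeightsAt v (𝓓 K ℓ v hv).algebra (𝓓 K ℓ v hv).𝔅 τ.toRingHom).Nodup := by
  letI := (𝓓 K ℓ v hv).algebra
  intro τ
  have key := h K hK n hn hcpt π T hT hreg ℓ ι r hss hc v hv τ
  have hinj : Function.Injective (fun hh : ℤ => (hh : ℂ)) := Int.cast_injective
  rw [← Multiset.nodup_map_iff_of_injective hinj, key]
  refine Multiset.Nodup.map (fun a b hab => ?_) (hreg.2 _)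
  simpa using hab

end AHTW2026

end Literature.NumberTheory.Automorphic
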